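import Literature.Computability.AlgebraicComplexity.GlobalStageThreeRegions
import HarnessLib

/-!
# VXXZ Theorem 5.3, asymptotic form: the lower-order terms are `o(n)` and the `ε`-loss is `o_{1/ε}(1)`
(Vassilevska Williams–Xu–Xu–Zhou 2024, Thm. 5.3: "`2^{(A₁E₁ + A₂E₂ + A₃E₃ − o_{1/ε}(1)) n − o(n)}`
independent copies … from `2^{o(n)}` independent copies") — proved

Topic `Literature/Computability/AlgebraicComplexity`.  `GlobalStageEpsilon.lean` /
`GlobalStageThreeRegions.lean` prove Thm. 5.3 at fixed `n` with the explicit error terms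
`thm53Err c n` (lower order) and `epsLoss c ε` (the `ε`-loss), from `inputCopies c n` copies of the
input.  This file PROVES the three little-`o` statements that turn them into the printed form:

* `tendsto_thm53Err_div` — `thm53Err c n / n → 0` (`log n`, `n / log n` and `√n` terms);
* `tendsto_logb_inputCopies_div` — `log₂ (inputCopies c n) / n → 0` (the input is `2^{o(n)}` copies);
* (`tendsto_epsLoss`, landed) — `epsLoss c ε → 0` as `ε → 0`;
* `vxxz2024_thm53_asymptotic` — **for every `δ > 0` there is `ε₀ > 0` such that for all
  `0 < ε ≤ ε₀` and all sufficiently large `n`, every region datum `D` of size `n` satisfies: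
  `2^{δn} ≥ inputCopies` copies of `(CW_q^{⊗c})^{⊗n}` degenerate to `κ` copies of the `ε`-interface
  tensor of `D` with `log₂(κ+1) ≥ n (E(D) − δ)`** — Thm. 5.3 (one region) as printed, uniformly in the
  datum.

Everything is proved; no definitions; no named facts.

## References

* V. Vassilevska Williams, Y. Xu, Z. Xu, R. Zhou, *New bounds for matrix multiplication: from alpha
  to omega*, SODA 2024, arXiv:2307.07970 (held: `paper:arxiv-2307.07970`), Thm. 5.3.
  [VassilevskaWilliamsXuXuZhou2024]
-/

noncomputable section

open scoped BigOperators Topology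
open Finset Filter

namespace Literature.Computability.AlgebraicComplexity

open Literature.Barriers.MatrixMultiplication (bigCwTensor)

universe u

/-! ## Elementary limits -/

section Limits

/-- `log₂(n+1)/n → 0`. [folklore] -/
theorem tendsto_logb_succ_div : Tendsto (fun n : ℕ => Real.logb 2 ((n : ℝ) + 1) / n) atTop (𝓝 0) := by
  have h := (Real.tendsto_pow_log_div_mul_add_atTop 1 (-1) 1 one_ne_zero).comp
    (tendsto_atTop_add_const_right atTop (1 : ℝ) tendsto_natCast_atTop_atTop)
  have h2 := h.div_const (Real.log 2)
  rw [zero_div] at h2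
  refine h2.congr' (Eventually.of_forall fun n => ?_)
  simp only [Function.comp, pow_one, Real.logb]
  have : (1 : ℝ) * ((n : ℝ) + 1) + -1 = n := by ring
  rw [this, div_div, div_div, mul_comm]

/-- `log n / n → 0` along the naturals. [folklore] -/
theorem tendsto_log_div_nat : Tendsto (fun n : ℕ => Real.log n / n) atTop (𝓝 0) := by
  have h := (Real.tendsto_pow_log_div_mul_add_atTop 1 0 1 one_ne_zero).comp tendsto_natCast_atTop_atTop
  refine h.congr' (Eventually.of_forall fun n => ?_)
  simp [Function.comp]

/-- `log₂(160 c n)/n → 0` (`c ≥ 1`). [folklore] -/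
theorem tendsto_logb_linear_div {c : ℕ} (hc : 0 < c) :
    Tendsto (fun n : ℕ => Real.logb 2 (160 * ((c : ℝ) * n)) / n) atTop (𝓝 0) := by
  have hA : Tendsto (fun n : ℕ => Real.log (160 * c) / Real.log 2 / n) atTop (𝓝 0) :=
    tendsto_const_div_atTop_nhds_zero_nat _
  have hB : Tendsto (fun n : ℕ => Real.log n / n / Real.log 2) atTop (𝓝 0) := by
    simpa using tendsto_log_div_nat.div_const (Real.log 2)
  have hAB := hA.add hB
  rw [add_zero] at hAB
  refine hAB.congr' ?_
  filter_upwards [eventually_ge_atTop 1] with n hn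
  have hn' : (0 : ℝ) < n := by exact_mod_cast hn
  have hcR : (0 : ℝ) < c := by exact_mod_cast hc
  have hc' : (0 : ℝ) < 160 * c := by positivity
  rw [Real.logb, show (160 : ℝ) * ((c : ℝ) * n) = 160 * c * n by ring, Real.log_mul hc'.ne' hn'.ne']
  ring

/-- `⌊log_{2cn} 3^{cn}⌋ / n → 0` (the batch size exponent of Cor. 4.2 is `O(n / log n)`). [folklore] -/
theorem tendsto_natLog_div {c : ℕ} (hc : 0 < c) :
    Tendsto (fun n : ℕ => (Nat.log (2 * (c * n)) (3 ^ (c * n)) : ℝ) / n) atTop (𝓝 0) := by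
  have hcR : (0 : ℝ) < c := by exact_mod_cast hc
  -- upper bound `c log 3 / log (2cn)`
  have h2cn : Tendsto (fun n : ℕ => (2 * ((c : ℝ) * n))) atTop atTop := by
    have : Tendsto (fun n : ℕ => (2 * c : ℝ) * n) atTop atTop :=
      tendsto_natCast_atTop_atTop.const_mul_atTop (by positivity)
    refine this.congr' (Eventually.of_forall fun n => ?_)
    ring
  have hlog : Tendsto (fun n : ℕ => Real.log (2 * ((c : ℝ) * n))) atTop atTop := Real.tendsto_log_atTop.comp h2cn
  have hinv : Tendsto (fun n : ℕ => (c : ℝ) * Real.log 3 * (Real.log (2 * ((c : ℝ) * n)))⁻¹) atTop (𝓝 0) := by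
    have := hlog.inv_tendsto_atTop.const_mul ((c : ℝ) * Real.log 3)
    rw [mul_zero] at this
    exact this
  refine tendsto_of_tendsto_of_tendsto_of_le_of_le' tendsto_const_nhds hinv
    (Eventually.of_forall fun n => by positivity) ?_
  filter_upwards [eventually_ge_atTop 1] with n hn
  have hn' : (0 : ℝ) < n := by exact_mod_cast hn
  have hn1 : (1 : ℝ) ≤ n := by exact_mod_cast hn
  have hc1 : (1 : ℝ) ≤ c := by exact_mod_cast hc
  have hbR : (1 : ℝ) < 2 * ((c : ℝ) * n) := by nlinarith
  have hlogb : 0 < Real.log (2 * ((c : ℝ) * n)) := Real.log_pos hbR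
  have hx : 3 ^ (c * n) ≠ 0 := pow_ne_zero _ (by norm_num)
  have hpow := Nat.pow_log_le_self (2 * (c * n)) hx
  -- `L · log b ≤ cn log 3`
  have hL : (Nat.log (2 * (c * n)) (3 ^ (c * n)) : ℝ) * Real.log (2 * ((c : ℝ) * n)) ≤ (c * n : ℝ) * Real.log 3 := by
    have h1 : (((2 * (c * n)) ^ Nat.log (2 * (c * n)) (3 ^ (c * n)) : ℕ) : ℝ) ≤ ((3 ^ (c * n) : ℕ) : ℝ) := by
      exact_mod_cast hpow
    have h2 := Real.log_le_log (by positivity) h1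
    push_cast at h2
    rw [Real.log_pow, Real.log_pow] at h2
    push_cast at h2
    exact h2
  rw [div_le_iff₀ hn']
  calc (Nat.log (2 * (c * n)) (3 ^ (c * n)) : ℝ)
      = (Nat.log (2 * (c * n)) (3 ^ (c * n)) : ℝ) * Real.log (2 * ((c : ℝ) * n)) * (Real.log (2 * ((c : ℝ) * n)))⁻¹ := by
        rw [mul_assoc, mul_inv_cancel₀ hlogb.ne', mul_one]
    _ ≤ (c * n : ℝ) * Real.log 3 * (Real.log (2 * ((c : ℝ) * n)))⁻¹ :=
        mul_le_mul_of_nonneg_right hL (inv_nonneg.2 hlogb.le)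
    _ = (c : ℝ) * Real.log 3 * (Real.log (2 * ((c : ℝ) * n)))⁻¹ * n := by ring

/-- `log₂ r₀ / n → 0` for the batch size `r₀ = 8^{3⌊log_{2cn}3^{cn}⌋+3}` of Cor. 4.2. [cite: VassilevskaWilliamsXuXuZhou2024, Cor. 4.2 (r = 2^{o(n)})] -/
theorem tendsto_logb_batch_div {c : ℕ} (hc : 0 < c) :
    Tendsto (fun n : ℕ => Real.logb 2 ((8 ^ (3 * Nat.log (2 * (c * n)) (3 ^ (c * n)) + 3) : ℕ) : ℝ) / n) atTop (𝓝 0) := by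
  have h8 : Real.logb 2 (8 : ℝ) = 3 := by
    rw [show (8 : ℝ) = 2 ^ (3 : ℕ) by norm_num, Real.logb_pow, Real.logb_self_eq_one one_lt_two]; norm_num
  have hA := (tendsto_natLog_div hc).const_mul 9
  have hB : Tendsto (fun n : ℕ => (9 : ℝ) / n) atTop (𝓝 0) := tendsto_const_div_atTop_nhds_zero_nat _
  have hAB := hA.add hB
  rw [mul_zero, add_zero] at hAB
  refine hAB.congr' (Eventually.of_forall fun n => ?_)
  push_cast
  rw [Real.logb_pow, h8]
  push_cast
  ring

/-- **A linear bound on `log(2 M̄)`**: `log(2 · crudeModulus c n) ≤ (168c + 11) n` for `n ≥ 1`. [folklore] -/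
theorem log_two_mul_crudeModulus_le (c : ℕ) {n : ℕ} (hn : 1 ≤ n) :
    Real.log (2 * crudeModulus c n) ≤ (168 * c + 11) * n := by
  have hn1 : (1 : ℝ) ≤ n := by exact_mod_cast hn
  have hc0 : (0 : ℝ) ≤ c := Nat.cast_nonneg c
  unfold crudeModulus
  push_cast
  have hP : (0 : ℝ) < 160 * (c * n) + 2 * c + 11 := by positivity
  have hQ : (0 : ℝ) < (2 * c + 1) ^ (3 * n) := by positivity
  rw [Real.log_mul (by norm_num) (mul_pos hP hQ).ne', Real.log_mul hP.ne' hQ.ne', Real.log_pow]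
  have h2 : Real.log 2 ≤ 1 := by
    have := Real.log_le_sub_one_of_pos (show (0:ℝ) < 2 by norm_num); linarith
  have h3 : Real.log (160 * (c * n) + 2 * c + 11) ≤ 160 * (c * n) + 2 * c + 10 := by
    have := Real.log_le_sub_one_of_pos hP; linarith
  have h4 : Real.log (2 * c + 1) ≤ 2 * c := by
    have := Real.log_le_sub_one_of_pos (show (0:ℝ) < 2 * c + 1 by positivity); linarith
  have h5 : ((3 * n : ℕ) : ℝ) * Real.log (2 * c + 1) ≤ 3 * n * (2 * c) := by
    push_cast
    exact mul_le_mul_of_nonneg_left h4 (by positivity)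
  have h6 : (2 * c + 11 : ℝ) ≤ (2 * c + 11) * n := le_mul_of_one_le_right (by positivity) hn1
  nlinarith

/-- `4√(log 2M̄)/(n log 2) → 0` (the Behrend loss is `2^{O(√n)}`). [cite: VassilevskaWilliamsXuXuZhou2024, §5.2 ("M^{1−o(1)}")] -/
theorem tendsto_sqrt_log_crudeModulus_div (c : ℕ) :
    Tendsto (fun n : ℕ => 4 * Real.sqrt (Real.log (2 * crudeModulus c n)) / Real.log 2 / n) atTop (𝓝 0) := by
  set C₀ : ℝ := 168 * c + 11 with hC₀
  have hC₀0 : 0 ≤ C₀ := by rw [hC₀]; positivity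
  have hlog2 : 0 < Real.log 2 := Real.log_pos one_lt_two
  -- the majorant `K (√n)⁻¹`
  have hmaj : Tendsto (fun n : ℕ => 4 / Real.log 2 * Real.sqrt C₀ * (Real.sqrt (n : ℝ))⁻¹) atTop (𝓝 0) := by
    have h := (tendsto_inv_atTop_zero.comp (Real.tendsto_sqrt_atTop.comp tendsto_natCast_atTop_atTop)).const_mul
      (4 / Real.log 2 * Real.sqrt C₀)
    rw [mul_zero] at h
    exact h
  refine tendsto_of_tendsto_of_tendsto_of_le_of_le' tendsto_const_nhds hmaj
    (Eventually.of_forall fun n => by positivity) ?_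
  filter_upwards [eventually_ge_atTop 1] with n hn
  have hn' : (0 : ℝ) < n := by exact_mod_cast hn
  have hsq : Real.sqrt (Real.log (2 * crudeModulus c n)) ≤ Real.sqrt C₀ * Real.sqrt n := by
    rw [← Real.sqrt_mul hC₀0]
    exact Real.sqrt_le_sqrt (log_two_mul_crudeModulus_le c hn)
  have hsn : 0 < Real.sqrt (n : ℝ) := Real.sqrt_pos.2 hn'
  have key : Real.sqrt (Real.log (2 * crudeModulus c n)) / n ≤ Real.sqrt C₀ * (Real.sqrt (n : ℝ))⁻¹ := by
    rw [div_le_iff₀ hn']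
    calc Real.sqrt (Real.log (2 * crudeModulus c n)) ≤ Real.sqrt C₀ * Real.sqrt n := hsq
      _ = Real.sqrt C₀ * (Real.sqrt (n : ℝ))⁻¹ * n := by
          rw [mul_assoc]
          congr 1
          rw [eq_comm, inv_mul_eq_iff_eq_mul₀ hsn.ne', ← Real.sqrt_mul hn'.le, Real.sqrt_mul_self hn'.le]
  calc 4 * Real.sqrt (Real.log (2 * crudeModulus c n)) / Real.log 2 / n
      = 4 / Real.log 2 * (Real.sqrt (Real.log (2 * crudeModulus c n)) / n) := by ring
    _ ≤ 4 / Real.log 2 * (Real.sqrt C₀ * (Real.sqrt (n : ℝ))⁻¹) :=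
        mul_le_mul_of_nonneg_left key (by positivity)
    _ = 4 / Real.log 2 * Real.sqrt C₀ * (Real.sqrt (n : ℝ))⁻¹ := by ring

/-- **`thm53Err c n / n → 0`**: the lower-order term of Thm. 5.3 is `o(n)`. [cite: VassilevskaWilliamsXuXuZhou2024, Thm. 5.3 ("− o(n)")] -/
theorem tendsto_thm53Err_div {c : ℕ} (hc : 0 < c) : Tendsto (fun n : ℕ => thm53Err c n / n) atTop (𝓝 0) := by
  have h1 := tendsto_logb_succ_div.const_mul
    ((2 * Fintype.card (Fin (2 * c + 1) × Fin (2 * c + 1) × Fin (2 * c + 1)) + (2 * c + 1) +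
      Fintype.card (Fin (2 * c + 1) × (Fin c → Fin 3)) : ℝ))
  have h2 := tendsto_logb_linear_div hc
  have h3 : Tendsto (fun n : ℕ => Real.logb 2 (2 * (c : ℝ) + 2) / n) atTop (𝓝 0) := tendsto_const_div_atTop_nhds_zero_nat _
  have h4 := tendsto_logb_batch_div hc
  have h5 := tendsto_sqrt_log_crudeModulus_div c
  have h6 : Tendsto (fun n : ℕ => (7 : ℝ) / n) atTop (𝓝 0) := tendsto_const_div_atTop_nhds_zero_nat _
  have hall := ((((h1.add h2).add h3).add h4).add h5).add h6
  simp only [mul_zero, add_zero] at hall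
  refine hall.congr' (Eventually.of_forall fun n => ?_)
  unfold thm53Err
  ring

/-- **`log₂ (inputCopies c n) / n → 0`**: the input of Thm. 5.3 is `2^{o(n)}` copies. [cite: VassilevskaWilliamsXuXuZhou2024, Thm. 5.3 ("2^{o(n)} independent copies")] -/
theorem tendsto_logb_inputCopies_div (c : ℕ) : Tendsto (fun n : ℕ => Real.logb 2 (inputCopies c n) / n) atTop (𝓝 0) := by
  have h := tendsto_logb_succ_div.const_mul ((3 * (3 ^ c * (constituentTriples c).card) : ℕ) : ℝ)
  rw [mul_zero] at h
  refine h.congr' (Eventually.of_forall fun n => ?_)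
  unfold inputCopies
  push_cast
  rw [← pow_mul, Real.logb_pow]
  push_cast
  ring

end Limits

/-! ## Theorem 5.3 in asymptotic form -/

section Asymptotic

variable (K : Type u) [CommSemiring K] (q : ℕ) {c : ℕ}

/-- **Vassilevska Williams–Xu–Xu–Zhou, Thm. 5.3 (one region), asymptotic form.**  For every `δ > 0`
there is `ε₀ > 0` such that for all `0 < ε ≤ ε₀` there is `n₀` with: for every `n ≥ n₀` and every
region datum `D` of size `n` (joint type `Q`, triple `T₀`, targets `γ`), `inputCopies c n ≤ 2^{δn}`
independent copies of `(CW_q^{⊗c})^{⊗n}` degenerate (restrict) to `κ` independent copies of the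
level-`ℓ` `ε`-interface tensor of `D` with `log₂(κ+1) ≥ n (E(D) − δ)`,
`E(D) = min{H(Q_X/n) − P, H(Q_Y/n) − P, H(γ̄_Z) − λ_Z, H(Q/n)}` — the printed
"`2^{o(n)}` copies … degenerate into `2^{(E₁ − o_{1/ε}(1))n − o(n)}` copies", uniformly in the datum.
[cite: VassilevskaWilliamsXuXuZhou2024, Thm. 5.3] -/
theorem vxxz2024_thm53_asymptotic (hc : 0 < c) {δ : ℝ} (hδ : 0 < δ) :
    ∃ ε₀ : ℝ, 0 < ε₀ ∧ ∀ ε : ℝ, 0 < ε → ε ≤ ε₀ → ∃ n₀ : ℕ, ∀ n : ℕ, n₀ ≤ n → ∀ D : RegionDatum c n,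
      Real.logb 2 (inputCopies c n) ≤ δ * n ∧
      ∃ κ : ℕ,
        TensorRestrictsTo (kroneckerTensor (unitTensor K (inputCopies c n)) (kroneckerPow (kroneckerPow (bigCwTensor K q) c) n))
          (kroneckerTensor (unitTensor K κ) (interfaceTensor K q D.termMap D.termList ε)) ∧
        (n : ℝ) * (D.exponent - δ) ≤ Real.logb 2 ((κ : ℝ) + 1) := by
  -- `ε₀` from `epsLoss → 0`
  obtain ⟨η, hη, hηε⟩ := Metric.tendsto_nhds_nhds.1 (tendsto_epsLoss c) (δ / 2) (by positivity)
  refine ⟨min (η / 2) 1, by positivity, fun ε hε0 hεle => ?_⟩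
  have hε1 : ε ≤ 1 := hεle.trans (min_le_right _ _)
  have hεη : dist ε 0 < η := by
    rw [Real.dist_eq, sub_zero, abs_of_pos hε0]
    have := min_le_left (η / 2) 1
    linarith
  have hloss : epsLoss c ε < δ / 2 := by
    have h := hηε hεη
    rw [Real.dist_eq, sub_zero] at h
    exact lt_of_abs_lt h
  -- `n₀` from the two little-o statements
  obtain ⟨n₁, hn₁⟩ := Metric.tendsto_atTop.1 (tendsto_thm53Err_div hc) (δ / 2) (by positivity)
  obtain ⟨n₂, hn₂⟩ := Metric.tendsto_atTop.1 (tendsto_logb_inputCopies_div c) δ hδ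
  refine ⟨max (max n₁ n₂) 1, fun n hn D => ?_⟩
  have hn1 : n₁ ≤ n := le_trans (le_max_left _ _) (le_trans (le_max_left _ _) hn)
  have hn2 : n₂ ≤ n := le_trans (le_max_right _ _) (le_trans (le_max_left _ _) hn)
  have hnpos : 0 < n := lt_of_lt_of_le Nat.one_pos (le_trans (le_max_right _ _) hn)
  have hnR : (0 : ℝ) < n := by exact_mod_cast hnpos
  have hErr : thm53Err c n ≤ δ / 2 * n := by
    have h := hn₁ n hn1
    rw [Real.dist_eq, sub_zero] at h
    have := (abs_lt.1 h).2
    rw [div_lt_iff₀ hnR] at this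
    linarith
  have hIn : Real.logb 2 (inputCopies c n) ≤ δ * n := by
    have h := hn₂ n hn2
    rw [Real.dist_eq, sub_zero] at h
    have := (abs_lt.1 h).2
    rw [div_lt_iff₀ hnR] at this
    linarith
  refine ⟨hIn, ?_⟩
  obtain ⟨κ, hres, hb⟩ := vxxz2024_thm53_regionDatum K q hc hnpos D hε0.le hε1
  refine ⟨κ, hres, le_trans ?_ hb⟩
  have : (n : ℝ) * epsLoss c ε ≤ n * (δ / 2) := mul_le_mul_of_nonneg_left hloss.le hnR.le
  nlinarith

/-- `inputCopies ≥ 1`. [folklore] -/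
theorem inputCopies_pos (c n : ℕ) : 0 < inputCopies c n := by
  unfold inputCopies; positivity

/-- **Thm. 5.3 (three regions), asymptotic form**: for every `δ > 0` there is `ε₀ > 0` such that for
all `0 < ε ≤ ε₀` there is `n₀` with: for all region sizes `n₁, n₂, n₃ ≥ n₀` and data `D₁, D₂, D₃`,
`N ≤ 2^{δ(n₁+n₂+n₃)}` independent copies of `(CW_q^{⊗c})^{⊗(n₁+n₂+n₃)}` degenerate to `κ₁κ₂κ₃` copies
of the `ε`-interface tensor with the concatenated parameter list (`Y`-shared second, `X`-shared third
region), `log₂(κ_r+1) ≥ n_r (E_r − δ)` — the printed `2^{(A₁E₁+A₂E₂+A₃E₃ − o_{1/ε}(1))n − o(n)}`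
copies from `2^{o(n)}` copies. [cite: VassilevskaWilliamsXuXuZhou2024, Thm. 5.3 and Prop. 5.1] -/
theorem vxxz2024_thm53_asymptotic₃ (hc : 0 < c) {δ : ℝ} (hδ : 0 < δ) :
    ∃ ε₀ : ℝ, 0 < ε₀ ∧ ∀ ε : ℝ, 0 < ε → ε ≤ ε₀ → ∃ n₀ : ℕ, ∀ n₁ n₂ n₃ : ℕ, n₀ ≤ n₁ → n₀ ≤ n₂ → n₀ ≤ n₃ →
      ∀ (D₁ : RegionDatum c n₁) (D₂ : RegionDatum c n₂) (D₃ : RegionDatum c n₃),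
      Real.logb 2 ((inputCopies c n₁ * inputCopies c n₂ * inputCopies c n₃ : ℕ) : ℝ) ≤ δ * (n₁ + n₂ + n₃) ∧
      ∃ κ₁ κ₂ κ₃ : ℕ,
        TensorRestrictsTo
          (kroneckerTensor (unitTensor K (inputCopies c n₁ * inputCopies c n₂ * inputCopies c n₃))
            (kroneckerPow (kroneckerPow (bigCwTensor K q) c) (n₁ + n₂ + n₃)))
          (kroneckerTensor (unitTensor K (κ₁ * κ₂ * κ₃))
            (interfaceTensor K q (concatTermMap (concatTermMap D₁.termMap D₂.termMap) D₃.termMap)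
              (Fin.append (Fin.append D₁.termList (fun t => (D₂.termList t).swapYZ)) (fun t => (D₃.termList t).swapXZ)) ε)) ∧
        (n₁ : ℝ) * (D₁.exponent - δ) ≤ Real.logb 2 ((κ₁ : ℝ) + 1) ∧
        (n₂ : ℝ) * (D₂.exponent - δ) ≤ Real.logb 2 ((κ₂ : ℝ) + 1) ∧
        (n₃ : ℝ) * (D₃.exponent - δ) ≤ Real.logb 2 ((κ₃ : ℝ) + 1) := by
  obtain ⟨ε₀, hε₀, h⟩ := vxxz2024_thm53_asymptotic K q hc hδ
  refine ⟨ε₀, hε₀, fun ε hε0 hεle => ?_⟩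
  obtain ⟨n₀, hn₀⟩ := h ε hε0 hεle
  refine ⟨n₀, fun n₁ n₂ n₃ hn₁ hn₂ hn₃ D₁ D₂ D₃ => ?_⟩
  obtain ⟨hI₁, κ₁, h₁, b₁⟩ := hn₀ n₁ hn₁ D₁
  obtain ⟨hI₂, κ₂, h₂, b₂⟩ := hn₀ n₂ hn₂ D₂
  obtain ⟨hI₃, κ₃, h₃, b₃⟩ := hn₀ n₃ hn₃ D₃
  refine ⟨?_, κ₁, κ₂, κ₃, ?_, b₁, b₂, b₃⟩
  · have p₁ : (0 : ℝ) < inputCopies c n₁ := by exact_mod_cast inputCopies_pos c n₁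
    have p₂ : (0 : ℝ) < inputCopies c n₂ := by exact_mod_cast inputCopies_pos c n₂
    have p₃ : (0 : ℝ) < inputCopies c n₃ := by exact_mod_cast inputCopies_pos c n₃
    push_cast
    rw [Real.logb_mul (mul_pos p₁ p₂).ne' p₃.ne', Real.logb_mul p₁.ne' p₂.ne']
    linarith
  · have h₂' := tensorRestrictsTo_inputCopies_swapYZ K q _ D₂.termMap D₂.termList ε κ₂ h₂
    have h₃' := tensorRestrictsTo_inputCopies_swapXZ K q _ D₃.termMap D₃.termList ε κ₃ h₃
    have h₁₂ := tensorRestrictsTo_inputCopies_mul K q D₁.termMap D₁.termList D₂.termMap (fun t => (D₂.termList t).swapYZ) ε h₁ h₂'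
    exact tensorRestrictsTo_inputCopies_mul K q _ _ D₃.termMap (fun t => (D₃.termList t).swapXZ) ε h₁₂ h₃'

end Asymptotic

end Literature.Computability.AlgebraicComplexity
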